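import Summits.QuantumFields.YangMills.Theorems.CheckerboardTrialityHyperoctahedralRung
import Summits.QuantumFields.YangMills.Theorems.BalabanLadderROTSingleAngle
import Mathlib.Topology.Algebra.Order.Archimedean
import HarnessLib

/-!
# Crux `ROT` (stmt-QuantumFields-20042), registered stub `stub_kingLimit : KingLimit` — the FREE (hypercubic) part of the stub and
# the planar-stabiliser dichotomy: the residual is «no UV limit point has a finite cyclic planar stabiliser `C_{4m}`»

Helper file (`--supports stmt-QuantumFields-20042`; seat `ymfull-r2d-prover-1`, R590-ym item (15)), line of record «King split»,
skeleton v4 «king-limit» (`Cruxes/ROT/Lines/birth.lean`, 824d5540ff52cfd5; ONE registered stub `stub_kingLimit : KingLimit`,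
`Theorems/BalabanLadderROTDefs.lean` §3).  ROAD-INDEPENDENT: everything below is about the body of the registered stub `KingLimit`
(limit-point King invariance on King's germ class), which every announced re-typing consumes (`KingLimit ⇒ KingLimitIR ⇒ KingLimitIROn S
⇒ KingOnClass`; suppliers `rotIR_of_rot`, `rot2'_of_kingOnClass`).

WHAT IS PROVED (0 sorry, standard axioms, no definition):
* §1 `isSignedPerm_planeRot_pi_div_two`, `quarterTurn_invariant_of_offDiagLimitAlong`, `zmultiples_quarterTurn_invariant_of_offDiagLimitAlong`
  — under `MomentBounds6 G r a` every off-diagonal limit point `S₁` of every admissible leg scheme (`OffDiagLimitAlong r sch φ S₁`) is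
  invariant on ALL of `⁰𝒮` under the rotations of the `(x₀,x₁)`-plane by the LATTICE angles `θ ∈ (π/2)ℤ` (the quarter turn is a signed
  permutation of the axes; ✓`CheckerboardTrialityHyperoctahedral.signedPerm_invariant_of_offDiagLimitAlong`, the `W(B₄)` rung).
* §2 `kingLimit_on_zmultiples_pi_div_two` — **the FREE PART of the registered stub**: the text of `KingLimit` VERBATIM with King's angle
  set `King.pythagoreanAngles` replaced by its subgroup `(π/2)ℤ` (`zmultiples_pi_div_two_le_pythagoreanAngles`: `cos, sin ∈ {0, ±1} ⊂ ℚ`)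
  HOLDS — for every compact simple `G`, every `r`, every positive unit map `a → 0` with `MomentBounds6`, at every radius.
* §3 `stabiliser_dichotomy` — for ANY one-field family with bounded densities off the diagonal (`OffDiagDensity`, clause 2 of
  `OffDiagLimitAlong`) whose germ class at radius `r₀` is fixed by the quarter turn, the planar stabiliser
  `{θ | ∀ n ≥ 2, ∀ F ∈ KingClass n r₀, S₁ n (R_θ F) = S₁ n F}` is a CLOSED additive subgroup of `ℝ` containing `π/2`, hence
  (Mathlib `AddSubgroup.dense_or_cyclic`) EITHER all of `ℝ` OR exactly `(π/(2m))ℤ` for one integer `m ≥ 1` (the finite rotation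
  group `C_{4m}` of the plane).  Corollaries: `stabiliser_univ_of_irrational` (one stabilising angle `θ` with `θ/π ∉ ℚ` gives all
  angles — the tree's single-angle criterion, here without a density argument), `stabiliser_univ_of_small` (stabilising angles
  accumulating at `0`).
* §4 ★ `kingLimit_iff_noCyclicStabiliser` — **the registered stub is EQUIVALENT to its residual**: `KingLimit` holds iff, in the same
  quantifier prefix, NO off-diagonal UV limit point has planar stabiliser `(π/(2m))ℤ`, `m ≥ 1`, on King's class.  So the entire open
  content of `stub_kingLimit` is the exclusion of the finite cyclic planar symmetry groups `C_{4m} ⊋ C₄` at every UV limit point of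
  lattice Yang–Mills; `MomentBounds6` and the lattice symmetries supply `C₄` and nothing more (cf. the shape barrier
  ✓`ROT.exists_momentBoundsShape_not_angularWardShape`, obstruction of record R110).

HONEST LABEL: structural bookkeeping on the registered stub; `KingLimit`, `ROT` and the Yang–Mills mass gap are NOT proved; every
statement here is finite-volume/lattice-side or about abstract limit points; no summit is proved by a line.

References: C. King, Commun. Math. Phys. 103 (1986) 323–349, Thm 2.4 (mechanism); K. Osterwalder, R. Schrader, CMP 31 (1973) §2;
J. Glimm, A. Jaffe, Quantum Physics (1987) §6.1; Bourbaki, Topologie Générale V §1 (closed subgroups of `ℝ`).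
-/

set_option autoImplicit false

noncomputable section

open scoped SchwartzMap
open MeasureTheory Filter Topology
open Literature.MathematicalPhysics.QuantumFieldTheory Literature.MathematicalPhysics.QuantumLattice
open Literature.MathematicalPhysics.AQFT Literature.Probability.LatticeModels
open Summit.QuantumFields.YangMills.Cruxes.OSLegsFromFemtoAndGap.DlrCollarTransfer
open Summit.QuantumFields.YangMills.Cruxes.OSLegsAtWeakCouplingC.Sketch
open Summit.QuantumFields.YangMills.Cruxes.OSLegsAtWeakCouplingC.Y2Bridge
open Summit.QuantumFields.YangMills.Theorems.OSLegsFromFemtoAndGap (latticeDist)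
open Summit.QuantumFields.YangMills.Theorems.OSLegsFromFemtoAndGap.Upgrade (isOffDiagonal_linActMulti)
open Summit.QuantumFields.YangMills.Theorems.NPointIsotropy.Negative (E4)
open Summit.QuantumFields.YangMills.Theorems.CurvatureBoostCovariance.BoostsInheritMirrors.OrbitBandlimit
  (linActMulti_planeRot_add planeRot_quarter_axes)
open Summit.QuantumFields.YangMills.Cruxes.OSLegsAtWeakCouplingC.Sketch.GermWard (linActMulti_planeRot_zero)
open Summit.QuantumFields.YangMills.Theorems.CheckerboardTrialityHyperoctahedral (signedPerm_invariant_of_offDiagLimitAlong)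

namespace Summit.QuantumFields.YangMills.Theorems.ROT.KingStabiliser

/-! ## §0 Two elementary facts about the lattice angles `(π/2)ℤ` -/

/-- **The quarter turn of the `(x₀,x₁)`-plane is a signed permutation of the coordinate axes** (`e₀ ↦ −e₁`, `e₁ ↦ e₀`, `e₂, e₃`
fixed). [folklore] -/
theorem isSignedPerm_planeRot_pi_div_two : IsSignedPerm (planeRot (0 : Fin 3) (Real.pi / 2)) :=
  fun i => planeRot_quarter_axes i

/-- **The lattice angles are Pythagorean**: `(π/2)ℤ ≤ King.pythagoreanAngles` (`cos (π/2) = 0`, `sin (π/2) = 1` are rational and the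
Pythagorean angles form a subgroup). [folklore] -/
theorem zmultiples_pi_div_two_le_pythagoreanAngles :
    AddSubgroup.zmultiples (Real.pi / 2) ≤ King.pythagoreanAngles := by
  rw [AddSubgroup.zmultiples_le]
  exact ⟨⟨0, by rw [Real.cos_pi_div_two]; push_cast; rfl⟩, ⟨1, by rw [Real.sin_pi_div_two]; push_cast; rfl⟩⟩

/-- Half of a non-zero generator is not an integer multiple of it: `c/2 ∉ cℤ` for `c ≠ 0`. [folklore] -/
theorem half_not_mem_zmultiples {c : ℝ} (hc : c ≠ 0) : c / 2 ∉ AddSubgroup.zmultiples c := by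
  intro h
  obtain ⟨k, hk⟩ := AddSubgroup.mem_zmultiples_iff.1 h
  rw [zsmul_eq_mul] at hk
  have h2 : (2 * (k : ℝ) - 1) * c = 0 := by linear_combination 2 * hk
  rcases mul_eq_zero.1 h2 with h' | h'
  · have h1 : (2 * k : ℤ) = 1 := by exact_mod_cast (sub_eq_zero.1 h')
    omega
  · exact hc h'

/-! ## §1 Quarter-turn invariance of every off-diagonal UV limit point (the `W(B₄)` rung, planar case) -/

section LimitPoints

variable {G : Type} [Group G] [TopologicalSpace G] [IsTopologicalGroup G] [CompactSpace G]
  [MeasurableSpace G] [BorelSpace G]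

/-- **Every off-diagonal limit point along a leg scheme is invariant under the quarter turn of the `(x₀,x₁)`-plane on `⁰𝒮`** (under
`MomentBounds6`): the quarter turn is a signed permutation, and ✓`signedPerm_invariant_of_offDiagLimitAlong` (permutations exact on the
lattice, axis reflections through the `O(a_k)` corner-shift defect killed by the plane-string bounds of `MomentBounds6`).
[cite: OS1973, §2] [cite: GlimmJaffe1987, §6.1] -/
theorem quarterTurn_invariant_of_offDiagLimitAlong (r : LatticeRep G) {a : ℝ → ℝ} (hapos : ∀ β, 0 < a β)
    (ha0 : Tendsto a atTop (𝓝 0)) (hMB : MomentBounds6 G r a) {sch : SpeciesScheme (YMSpecies G)} (hsch : IsLegScheme a sch)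
    {φ : ℕ → ℕ} (hφ : Tendsto φ atTop atTop) {S₁ : SchwingerFamily E4} (hS₁ : OffDiagLimitAlong r sch φ S₁)
    (n : ℕ) (F : 𝓢((Fin n → E4), ℂ)) (hF : IsOffDiagonal F) :
    S₁ n (linActMulti (planeRot (0 : Fin 3) (Real.pi / 2)) F) = S₁ n F :=
  signedPerm_invariant_of_offDiagLimitAlong r hapos ha0 hMB hsch hφ hS₁ _ isSignedPerm_planeRot_pi_div_two n F hF

/-- **The arity-`n` stabiliser on `⁰𝒮ₙ` is an additive subgroup of the angles** (group law of the plane rotations; `⁰𝒮ₙ` is stable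
under every linear isometry).  Stated without a definition: the subgroup is exhibited. [folklore] -/
theorem exists_stabiliser_offDiag (S₁ : SchwingerFamily E4) (n : ℕ) :
    ∃ H : AddSubgroup ℝ, (H : Set ℝ) =
      {θ : ℝ | ∀ F : 𝓢((Fin n → E4), ℂ), IsOffDiagonal F → S₁ n (linActMulti (planeRot (0 : Fin 3) θ) F) = S₁ n F} :=
  ⟨{ carrier := {θ : ℝ | ∀ F : 𝓢((Fin n → E4), ℂ), IsOffDiagonal F → S₁ n (linActMulti (planeRot (0 : Fin 3) θ) F) = S₁ n F}
     zero_mem' := fun F _ => by rw [linActMulti_planeRot_zero]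
     add_mem' := fun {θ₁ θ₂} h₁ h₂ F hF => by
       show S₁ n (linActMulti (planeRot (0 : Fin 3) (θ₁ + θ₂)) F) = S₁ n F
       rw [linActMulti_planeRot_add, h₂ _ (isOffDiagonal_linActMulti _ hF), h₁ F hF]
     neg_mem' := fun {θ} h F hF => by
       show S₁ n (linActMulti (planeRot (0 : Fin 3) (-θ)) F) = S₁ n F
       have h' := h _ (isOffDiagonal_linActMulti (planeRot (0 : Fin 3) (-θ)) hF)
       rw [← linActMulti_planeRot_add, neg_add_cancel, linActMulti_planeRot_zero] at h'
       exact h'.symm }, rfl⟩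

/-- **Every off-diagonal limit point is invariant on `⁰𝒮` under ALL lattice angles `θ ∈ (π/2)ℤ`** (the subgroup generated by the
quarter turn). [cite: OS1973, §2] [cite: GlimmJaffe1987, §6.1] -/
theorem zmultiples_quarterTurn_invariant_of_offDiagLimitAlong (r : LatticeRep G) {a : ℝ → ℝ} (hapos : ∀ β, 0 < a β)
    (ha0 : Tendsto a atTop (𝓝 0)) (hMB : MomentBounds6 G r a) {sch : SpeciesScheme (YMSpecies G)} (hsch : IsLegScheme a sch)
    {φ : ℕ → ℕ} (hφ : Tendsto φ atTop atTop) {S₁ : SchwingerFamily E4} (hS₁ : OffDiagLimitAlong r sch φ S₁)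
    (n : ℕ) (F : 𝓢((Fin n → E4), ℂ)) (hF : IsOffDiagonal F) {θ : ℝ} (hθ : θ ∈ AddSubgroup.zmultiples (Real.pi / 2)) :
    S₁ n (linActMulti (planeRot (0 : Fin 3) θ) F) = S₁ n F := by
  obtain ⟨H, hH⟩ := exists_stabiliser_offDiag S₁ n
  have hq : Real.pi / 2 ∈ H := by
    rw [← SetLike.mem_coe, hH]
    exact fun F hF => quarterTurn_invariant_of_offDiagLimitAlong r hapos ha0 hMB hsch hφ hS₁ n F hF
  have hθH : θ ∈ (H : Set ℝ) := (AddSubgroup.zmultiples_le.2 hq) hθ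
  rw [hH] at hθH
  exact hθH F hF

end LimitPoints

/-! ## §2 The FREE PART of the registered stub: `KingLimit` on the lattice angles `(π/2)ℤ` -/

/-- ★ **`KingLimit` restricted to the lattice angles HOLDS.**  The text of the registered stub `Theorems.ROT.KingLimit` VERBATIM with King's
angle set `King.pythagoreanAngles` replaced by its subgroup `(π/2)ℤ` (`zmultiples_pi_div_two_le_pythagoreanAngles`): for every compact simple
`G`, every `r`, every positive unit map `a → 0` carrying `MomentBounds6 G r a` and every admissible scheme there is `r₀ > 0` (any radius
works; `r₀ = 1` is returned) such that every off-diagonal limit point along every subsequence is invariant on King's class under the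
quarter turns.  This is the part of `stub_kingLimit` paid for by the lattice symmetries; the open content is ONE non-lattice Pythagorean
angle (✓`kingLimit_iff_kingSingle`), equivalently §4 below. [cite: OS1973, §2] [cite: GlimmJaffe1987, §6.1] -/
theorem kingLimit_on_zmultiples_pi_div_two :
    ∀ (G : Type) [Group G] [TopologicalSpace G] [IsTopologicalGroup G] [CompactSpace G],
      IsCompactSimpleLieGroup G → letI : MeasurableSpace G := borel G; haveI : BorelSpace G := ⟨rfl⟩;
      ∀ (r : LatticeRep G) (a : ℝ → ℝ), (∀ β, 0 < a β) → Tendsto a atTop (𝓝 0) → MomentBounds6 G r a →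
        ∀ sch : SpeciesScheme (YMSpecies G), IsLegScheme a sch → ∃ r₀ : ℝ, 0 < r₀ ∧
          ∀ φ : ℕ → ℕ, Tendsto φ atTop atTop → ∀ S₁ : SchwingerFamily E4, OffDiagLimitAlong r sch φ S₁ →
            ∀ (n : ℕ), 2 ≤ n → ∀ F ∈ King.KingClass n r₀, ∀ θ ∈ (AddSubgroup.zmultiples (Real.pi / 2) : Set ℝ),
              S₁ n (linActMulti (planeRot (0 : Fin 3) θ) F) = S₁ n F := by
  intro G _ _ _ _ _
  letI : MeasurableSpace G := borel G
  haveI : BorelSpace G := ⟨rfl⟩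
  intro r a hapos ha0 hMB sch hsch
  refine ⟨1, one_pos, fun φ hφ S₁ hS₁ n _ F hF θ hθ => ?_⟩
  exact zmultiples_quarterTurn_invariant_of_offDiagLimitAlong r hapos ha0 hMB hsch hφ hS₁ n F hF.1 hθ

/-! ## §3 The planar stabiliser on King's class: a closed subgroup containing `π/2`, hence `ℝ` or `(π/(2m))ℤ` -/

/-- **The planar stabiliser of a one-field family on King's class (all arities `≥ 2`) is an additive subgroup of the angles, CLOSED when
the family has bounded densities off the diagonal** (orbit functions are continuous: ✓`King.continuous_orbit`; King's class is stable under
the plane rotations: ✓`King.linActMulti_mem_kingClass`).  Exhibited, not defined. [cite: King1986II, Thm 2.4 — mechanism] -/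
theorem exists_closed_stabiliser_kingClass (S₁ : SchwingerFamily E4) (hdens : OffDiagDensity S₁) (r₀ : ℝ) :
    ∃ H : AddSubgroup ℝ, IsClosed (H : Set ℝ) ∧ (H : Set ℝ) =
      {θ : ℝ | ∀ n : ℕ, 2 ≤ n → ∀ F ∈ King.KingClass n r₀, S₁ n (linActMulti (planeRot (0 : Fin 3) θ) F) = S₁ n F} := by
  let H : AddSubgroup ℝ :=
    { carrier := {θ : ℝ | ∀ n : ℕ, 2 ≤ n → ∀ F ∈ King.KingClass n r₀, S₁ n (linActMulti (planeRot (0 : Fin 3) θ) F) = S₁ n F}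
      zero_mem' := fun n _ F _ => by rw [linActMulti_planeRot_zero]
      add_mem' := fun {θ₁ θ₂} h₁ h₂ n hn F hF => by
        show S₁ n (linActMulti (planeRot (0 : Fin 3) (θ₁ + θ₂)) F) = S₁ n F
        rw [linActMulti_planeRot_add, h₂ n hn _ (King.linActMulti_mem_kingClass hF _), h₁ n hn F hF]
      neg_mem' := fun {θ} h n hn F hF => by
        show S₁ n (linActMulti (planeRot (0 : Fin 3) (-θ)) F) = S₁ n F
        have h' := h n hn _ (King.linActMulti_mem_kingClass hF (planeRot (0 : Fin 3) (-θ)))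
        rw [← linActMulti_planeRot_add, neg_add_cancel, linActMulti_planeRot_zero] at h'
        exact h'.symm }
  refine ⟨H, ?_, rfl⟩
  have hH : (H : Set ℝ) = ⋂ (n : ℕ) (_ : 2 ≤ n) (F : 𝓢((Fin n → E4), ℂ)) (_ : F ∈ King.KingClass n r₀),
      {θ : ℝ | S₁ n (linActMulti (planeRot (0 : Fin 3) θ) F) = S₁ n F} := by
    ext θ
    simp only [Set.mem_iInter, Set.mem_setOf_eq]
    rfl
  rw [hH]
  refine isClosed_iInter fun n => isClosed_iInter fun _ => isClosed_biInter fun F hF => ?_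
  obtain ⟨-, hFc, ⟨δ, hδ, hFδ⟩, -⟩ := hF
  exact isClosed_eq (King.continuous_orbit S₁ hdens F hFc hδ hFδ) continuous_const

/-- ★ **STABILISER DICHOTOMY.**  Let `S₁` be a one-field family with bounded densities off the diagonal whose King class at radius `r₀`
(all arities `≥ 2`) is fixed by the quarter turn of the `(x₀,x₁)`-plane.  Then EITHER `S₁` is fixed on that class by the rotations of
the plane by EVERY angle, OR its planar stabiliser is EXACTLY `(π/(2m))ℤ` for an integer `m ≥ 1` — the finite rotation group `C_{4m}`.
(A closed subgroup of `ℝ` is dense-hence-everything or cyclic, Mathlib `AddSubgroup.dense_or_cyclic`; a cyclic group `aℤ ∋ π/2` has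
`a = ±π/(2m)`.) [cite: King1986II, Thm 2.4 — mechanism] -/
theorem stabiliser_dichotomy (S₁ : SchwingerFamily E4) (hdens : OffDiagDensity S₁) (r₀ : ℝ)
    (hq : ∀ n : ℕ, 2 ≤ n → ∀ F ∈ King.KingClass n r₀, S₁ n (linActMulti (planeRot (0 : Fin 3) (Real.pi / 2)) F) = S₁ n F) :
    (∀ (θ : ℝ) (n : ℕ), 2 ≤ n → ∀ F ∈ King.KingClass n r₀, S₁ n (linActMulti (planeRot (0 : Fin 3) θ) F) = S₁ n F) ∨
    ∃ m : ℕ, 1 ≤ m ∧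
      {θ : ℝ | ∀ n : ℕ, 2 ≤ n → ∀ F ∈ King.KingClass n r₀, S₁ n (linActMulti (planeRot (0 : Fin 3) θ) F) = S₁ n F} =
        (AddSubgroup.zmultiples (Real.pi / (2 * m)) : Set ℝ) := by
  obtain ⟨H, hHc, hH⟩ := exists_closed_stabiliser_kingClass S₁ hdens r₀
  have hqH : Real.pi / 2 ∈ H := by
    rw [← SetLike.mem_coe, hH]
    exact hq
  rcases H.dense_or_cyclic with hd | ⟨g, hg⟩
  · -- dense and closed: the stabiliser is everything
    left
    intro θ
    have hθ : θ ∈ (H : Set ℝ) := by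
      rw [← hHc.closure_eq, hd.closure_eq]
      exact Set.mem_univ θ
    rw [hH] at hθ
    exact hθ
  · -- cyclic `gℤ ∋ π/2`: `π/2 = k • g`, `k ≠ 0`, `g = ± π/(2|k|)`
    right
    rw [← AddSubgroup.zmultiples_eq_closure] at hg
    have hk := hqH
    rw [hg, AddSubgroup.mem_zmultiples_iff] at hk
    obtain ⟨k, hk⟩ := hk
    rw [zsmul_eq_mul] at hk
    have hk0 : k ≠ 0 := by
      rintro rfl
      simp only [Int.cast_zero, zero_mul] at hk
      exact Real.pi_ne_zero (by linarith)
    refine ⟨k.natAbs, Int.natAbs_pos.2 hk0, ?_⟩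
    rw [← hH, hg]
    -- `g = (π/2)/k` and `zmultiples g = zmultiples |g|`
    have hkR : (k : ℝ) ≠ 0 := by exact_mod_cast hk0
    have hgk : g = Real.pi / 2 / k := by
      rw [eq_div_iff hkR, mul_comm]
      exact hk
    have habs : (k.natAbs : ℝ) = |(k : ℝ)| := by
      rw [Nat.cast_natAbs, Int.cast_abs]
    have hgoal : Real.pi / (2 * (k.natAbs : ℝ)) = |g| := by
      rw [habs, hgk, abs_div, abs_of_pos (by positivity : (0 : ℝ) < Real.pi / 2)]
      ring
    rw [hgoal]
    rcases abs_choice g with h | h <;> rw [h]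
    rw [AddSubgroup.zmultiples_neg]

/-- **One stabilising angle off `(π/2)ℚ` gives every angle**: under the hypotheses of `stabiliser_dichotomy`, if some `θ` with `θ/π`
irrational fixes `S₁` on King's class, then every angle does (`θ ∈ (π/(2m))ℤ` would make `θ/π = j/(2m)` rational).  This is the tree's
single-angle criterion (✓`rot_of_kingSingleLimit`, `θ/2π ∉ ℚ`) obtained from the dichotomy instead of a density argument.
[cite: King1986II, Thm 2.4 — mechanism] -/
theorem stabiliser_univ_of_irrational (S₁ : SchwingerFamily E4) (hdens : OffDiagDensity S₁) (r₀ : ℝ)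
    (hq : ∀ n : ℕ, 2 ≤ n → ∀ F ∈ King.KingClass n r₀, S₁ n (linActMulti (planeRot (0 : Fin 3) (Real.pi / 2)) F) = S₁ n F)
    {θ₀ : ℝ} (hirr : Irrational (θ₀ / Real.pi))
    (hθ₀ : ∀ n : ℕ, 2 ≤ n → ∀ F ∈ King.KingClass n r₀, S₁ n (linActMulti (planeRot (0 : Fin 3) θ₀) F) = S₁ n F) :
    ∀ (θ : ℝ) (n : ℕ), 2 ≤ n → ∀ F ∈ King.KingClass n r₀, S₁ n (linActMulti (planeRot (0 : Fin 3) θ) F) = S₁ n F := by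
  rcases stabiliser_dichotomy S₁ hdens r₀ hq with h | ⟨m, hm, hEq⟩
  · exact h
  · exfalso
    have hmem : θ₀ ∈ (AddSubgroup.zmultiples (Real.pi / (2 * m)) : Set ℝ) := by
      rw [← hEq]
      exact hθ₀
    obtain ⟨j, hj⟩ := AddSubgroup.mem_zmultiples_iff.1 hmem
    rw [zsmul_eq_mul] at hj
    have hmR : (m : ℝ) ≠ 0 := by exact_mod_cast (show m ≠ 0 by omega)
    refine hirr ⟨(j : ℚ) / (2 * m), ?_⟩
    rw [← hj]
    push_cast
    field_simp

/-- **Stabilising angles accumulating at `0` give every angle**: under the hypotheses of `stabiliser_dichotomy`, if for every `ε > 0`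
some angle `θ ∈ (0, ε)` fixes `S₁` on King's class, then every angle does (the cyclic alternative `(π/(2m))ℤ` has no element in
`(0, π/(2m))`). [cite: King1986II, Thm 2.4 — mechanism] -/
theorem stabiliser_univ_of_small (S₁ : SchwingerFamily E4) (hdens : OffDiagDensity S₁) (r₀ : ℝ)
    (hq : ∀ n : ℕ, 2 ≤ n → ∀ F ∈ King.KingClass n r₀, S₁ n (linActMulti (planeRot (0 : Fin 3) (Real.pi / 2)) F) = S₁ n F)
    (hsmall : ∀ ε : ℝ, 0 < ε → ∃ θ : ℝ, 0 < θ ∧ θ < ε ∧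
      ∀ n : ℕ, 2 ≤ n → ∀ F ∈ King.KingClass n r₀, S₁ n (linActMulti (planeRot (0 : Fin 3) θ) F) = S₁ n F) :
    ∀ (θ : ℝ) (n : ℕ), 2 ≤ n → ∀ F ∈ King.KingClass n r₀, S₁ n (linActMulti (planeRot (0 : Fin 3) θ) F) = S₁ n F := by
  rcases stabiliser_dichotomy S₁ hdens r₀ hq with h | ⟨m, hm, hEq⟩
  · exact h
  · exfalso
    have hmR : (0 : ℝ) < m := by exact_mod_cast hm
    have hc : 0 < Real.pi / (2 * m) := by positivity
    obtain ⟨θ, hθ0, hθε, hθ⟩ := hsmall (Real.pi / (2 * m)) hc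
    have hmem : θ ∈ (AddSubgroup.zmultiples (Real.pi / (2 * m)) : Set ℝ) := by
      rw [← hEq]
      exact hθ
    obtain ⟨j, hj⟩ := AddSubgroup.mem_zmultiples_iff.1 hmem
    rw [zsmul_eq_mul] at hj
    -- `0 < j c < c` forces `0 < j < 1`
    have hj0 : (0 : ℝ) < j := by
      by_contra hle
      push Not at hle
      have : (j : ℝ) * (Real.pi / (2 * m)) ≤ 0 := mul_nonpos_of_nonpos_of_nonneg hle hc.le
      linarith
    have hj1 : (j : ℝ) < 1 := by
      by_contra hle
      push Not at hle
      have : Real.pi / (2 * m) ≤ (j : ℝ) * (Real.pi / (2 * m)) := le_mul_of_one_le_left hc.le hle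
      linarith
    have hj0' : (0 : ℤ) < j := by exact_mod_cast hj0
    have hj1' : j < (1 : ℤ) := by exact_mod_cast hj1
    omega

/-! ## §4 ★ The registered stub is equivalent to its residual: no finite cyclic planar stabiliser at any UV limit point -/

/-- ★ **`KingLimit` ⇔ NO off-diagonal UV limit point has a finite cyclic planar stabiliser.**  In the quantifier prefix of the registered
stub: `KingLimit` holds iff for every compact simple `G`, every `r`, every positive unit map `a → 0` with `MomentBounds6 G r a` and every
admissible scheme there is `r₀ > 0` such that for every subsequence `φ → ∞` and every off-diagonal limit point `S₁`, the planar stabiliser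
of `S₁` on King's class at radius `r₀` is NOT `(π/(2m))ℤ` for any `m ≥ 1`.  (`⇒`: the stub gives invariance at the dense Pythagorean
angles, hence at all angles by ✓`King.orbit_eq_of_king`, and `ℝ ≠ (π/(2m))ℤ` since `π/(4m) ∉ (π/(2m))ℤ`; `⇐`: §1 gives the quarter turn,
§3 the dichotomy.)  READING: the open content of `stub_kingLimit` is exactly the exclusion of the planar symmetry groups `C_{4m}`,
`m ≥ 1`, at the UV limit points of lattice Yang–Mills — a dynamical statement on which `MomentBounds6` and the lattice symmetries are
silent. [cite: King1986II, Thm 2.4 — mechanism] [cite: OS1973, §2] -/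
theorem kingLimit_iff_noCyclicStabiliser :
    KingLimit ↔
    ∀ (G : Type) [Group G] [TopologicalSpace G] [IsTopologicalGroup G] [CompactSpace G],
      IsCompactSimpleLieGroup G → letI : MeasurableSpace G := borel G; haveI : BorelSpace G := ⟨rfl⟩;
      ∀ (r : LatticeRep G) (a : ℝ → ℝ), (∀ β, 0 < a β) → Tendsto a atTop (𝓝 0) → MomentBounds6 G r a →
        ∀ sch : SpeciesScheme (YMSpecies G), IsLegScheme a sch → ∃ r₀ : ℝ, 0 < r₀ ∧
          ∀ φ : ℕ → ℕ, Tendsto φ atTop atTop → ∀ S₁ : SchwingerFamily E4, OffDiagLimitAlong r sch φ S₁ →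
            ∀ m : ℕ, 1 ≤ m →
              {θ : ℝ | ∀ n : ℕ, 2 ≤ n → ∀ F ∈ King.KingClass n r₀, S₁ n (linActMulti (planeRot (0 : Fin 3) θ) F) = S₁ n F} ≠
                (AddSubgroup.zmultiples (Real.pi / (2 * m)) : Set ℝ) := by
  constructor
  · intro hKL G _ _ _ _ hG
    letI : MeasurableSpace G := borel G
    haveI : BorelSpace G := ⟨rfl⟩
    intro r a hapos ha0 hMB sch hsch
    obtain ⟨r₀, hr₀, H⟩ := hKL G hG r a hapos ha0 hMB sch hsch
    refine ⟨r₀, hr₀, fun φ hφ S₁ hS₁ m hm hEq => ?_⟩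
    have hdens : OffDiagDensity S₁ := hS₁.2.1
    -- invariance at the (dense) Pythagorean angles gives invariance at every angle
    have hall : ∀ (θ : ℝ) (n : ℕ), 2 ≤ n → ∀ F ∈ King.KingClass n r₀,
        S₁ n (linActMulti (planeRot (0 : Fin 3) θ) F) = S₁ n F := fun θ n hn F hF =>
      King.orbit_eq_of_king S₁ hdens King.dense_closure_pythagoreanAngles (H φ hφ S₁ hS₁ n hn) F hF θ
    have hmR : (0 : ℝ) < m := by exact_mod_cast hm
    have hc : Real.pi / (2 * m) ≠ 0 := (by positivity : (0 : ℝ) < Real.pi / (2 * m)).ne'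
    have hmem : Real.pi / (2 * m) / 2 ∈ (AddSubgroup.zmultiples (Real.pi / (2 * m)) : Set ℝ) := by
      rw [← hEq]
      exact fun n hn F hF => hall _ n hn F hF
    exact half_not_mem_zmultiples hc hmem
  · intro h G _ _ _ _ hG
    letI : MeasurableSpace G := borel G
    haveI : BorelSpace G := ⟨rfl⟩
    intro r a hapos ha0 hMB sch hsch
    obtain ⟨r₀, hr₀, H⟩ := h G hG r a hapos ha0 hMB sch hsch
    refine ⟨r₀, hr₀, fun φ hφ S₁ hS₁ n hn F hF θ _ => ?_⟩
    have hq : ∀ n : ℕ, 2 ≤ n → ∀ F ∈ King.KingClass n r₀,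
        S₁ n (linActMulti (planeRot (0 : Fin 3) (Real.pi / 2)) F) = S₁ n F := fun n _ F hF =>
      quarterTurn_invariant_of_offDiagLimitAlong r hapos ha0 hMB hsch hφ hS₁ n F hF.1
    rcases stabiliser_dichotomy S₁ hS₁.2.1 r₀ hq with hall | ⟨m, hm, hEq⟩
    · exact hall θ n hn F hF
    · exact absurd hEq (H φ hφ S₁ hS₁ m hm)

end Summit.QuantumFields.YangMills.Theorems.ROT.KingStabiliser

end
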